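import Summits.RiemannHypothesis.RiemannHypothesis.Theses.GroundBarta
import Summits.RiemannHypothesis.RiemannHypothesis.Theorems.WeilRouteProps.GroundBarta

/-!
# `Iff.rfl` bridges: Theses-free copies ↔ route propositions (route `GroundBarta`)

LEAF module (imports the route file; nothing imports this): for every statement item `X` of route `GroundBarta` the copy
`Summit.RiemannHypothesis.RiemannHypothesis.Theorems.WeilRouteProps.GroundBarta.X` and the route declaration
`Summit.RiemannHypothesis.RiemannHypothesis.Theses.GroundBarta.X` are the same proposition, by `Iff.rfl` (definitional unfolding).
If a route statement is ever restated, this file stops elaborating — the signal to re-sync the copy. Build refactor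
(21-frontier 2026-08-26T18:52:29Z); nothing here bears on the truth of RH.
-/

namespace Summit.RiemannHypothesis.RiemannHypothesis.Theorems.WeilRouteProps.GroundBarta

/-- The Theses-free copy `WeilRouteProps.GroundBarta.GroundBartaFloor` IS the route proposition `Theses.GroundBarta.GroundBartaFloor` (item stmt-RiemannHypothesis-18389):
definitional unfolding (`Iff.rfl`). -/
theorem GroundBartaFloor_iff :
    GroundBartaFloor ↔ Summit.RiemannHypothesis.RiemannHypothesis.Theses.GroundBarta.GroundBartaFloor :=
  Iff.rfl

/-- The Theses-free copy `WeilRouteProps.GroundBarta.PolarPerronFrobenius` IS the route proposition `Theses.GroundBarta.PolarPerronFrobenius` (item stmt-RiemannHypothesis-18390):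
definitional unfolding (`Iff.rfl`). -/
theorem PolarPerronFrobenius_iff :
    PolarPerronFrobenius ↔ Summit.RiemannHypothesis.RiemannHypothesis.Theses.GroundBarta.PolarPerronFrobenius :=
  Iff.rfl

/-- The Theses-free copy `WeilRouteProps.GroundBarta.EvenWinsBeyondArch` IS the route proposition `Theses.GroundBarta.EvenWinsBeyondArch` (item stmt-RiemannHypothesis-18807):
definitional unfolding (`Iff.rfl`). -/
theorem EvenWinsBeyondArch_iff :
    EvenWinsBeyondArch ↔ Summit.RiemannHypothesis.RiemannHypothesis.Theses.GroundBarta.EvenWinsBeyondArch :=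
  Iff.rfl

/-- The Theses-free copy `WeilRouteProps.GroundBarta.OddNegativityOffLine` IS the route proposition `Theses.GroundBarta.OddNegativityOffLine` (item stmt-RiemannHypothesis-18391):
definitional unfolding (`Iff.rfl`). -/
theorem OddNegativityOffLine_iff :
    OddNegativityOffLine ↔ Summit.RiemannHypothesis.RiemannHypothesis.Theses.GroundBarta.OddNegativityOffLine :=
  Iff.rfl

/-- The Theses-free copy `WeilRouteProps.GroundBarta.Assembly` IS the route proposition `Theses.GroundBarta.Assembly` (item stmt-RiemannHypothesis-18392):
definitional unfolding (`Iff.rfl`). -/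
theorem Assembly_iff :
    Assembly ↔ Summit.RiemannHypothesis.RiemannHypothesis.Theses.GroundBarta.Assembly :=
  Iff.rfl

end Summit.RiemannHypothesis.RiemannHypothesis.Theorems.WeilRouteProps.GroundBarta
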